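import Mathlib
import HarnessLib
import Summits.QuantumFields.YangMills.Theorems.MirrorModularBoostsHypercubicLimitCouplingResponseDefsC

/-!
# A plane-resolved moment bound for `k ≥ k₀` is a bound for all `k` (stub `stub_eventually`)

Stub `stub_eventually` of line `Sketch` for crux `SelfNormalisedMomentBoundsR` (item `stmt-QuantumFields-18014`,
route `ScalingWindowSplit` of `QuantumFields/YangMills`).  Pure proof file.

If the plane-resolved moment bound `|∫ ∏ᵢ Φ^P_k(Fᵢ) dμ_k| ≤ C₀ C₁ⁿ n!` holds for all normalised, pairwise plane-wise
disjointly supported families and all `k ≥ k₀`, then `UniformMomentBoundsPlanes r S` holds (same Schwartz order, other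
constants).  At a FIXED step `k`:

* `exists_uniform_bound_fieldP` — a normalised 6-tuple (`normP s F ≤ 1`) has `|F q y| ≤ 1` everywhere
  (`norm_le_schwartzNorm`), so its field is bounded by a constant `B_k` uniformly in `F` and in the configuration
  (the six plaquette observables are bounded, the box is finite);
* `card_le_card_box` — if every field `Φ^P_k(Fᵢ)(U)` of a pairwise plane-wise disjoint family is non-zero at some
  configuration, each `Fᵢ` is non-zero at some lattice point `a_k x`, `x ∈ box 4 L_k`, and distinct `i` need distinct
  points: `n ≤ #box = (2L_k+1)⁴` (pigeonhole);
* `abs_prod_fieldP_le` — hence `|∏ᵢ Φ^P_k(Fᵢ)(U)| ≤ (max 1 B_k)^{#box}` for every `n` (either a factor vanishes or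
  `n ≤ #box`), and the same bound for the integral against the probability measure `wilsonAt r S k`;
* `stub_eventually` — `C₀' = |C₀| + Σ_{k<k₀} (max 1 B_k)^{#box_k}`, `C₁' = max |C₁| 1`.
-/

noncomputable section

open scoped SchwartzMap BigOperators Topology
open MeasureTheory Filter Topology
open Literature.MathematicalPhysics.AQFT Literature.MathematicalPhysics.QuantumLattice
open Literature.MathematicalPhysics.QuantumFieldTheory Literature.Probability.LatticeModels
open Summit.QuantumFields.YangMills.Cruxes.HypercubicLimit.CouplingResponse

namespace Summit.QuantumFields.YangMills.Theorems.ScalingWindowSplit.SelfNormalisedMomentBoundsR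

namespace StubEventually

variable {G : Type} [Group G] [TopologicalSpace G] [IsTopologicalGroup G] [CompactSpace G]
  [MeasurableSpace G] [BorelSpace G]

/-- Every component of a 6-tuple is pointwise bounded by the total Schwartz norm: `|F q y| ≤ normP s F`. [folklore] -/
theorem abs_apply_le_normP (s : ℕ) (F : Plane → 𝓢(EuclideanSpace ℝ (Fin 4), ℝ)) (q : Plane)
    (y : EuclideanSpace ℝ (Fin 4)) : |F q y| ≤ normP s F := by
  have h1 : |F q y| ≤ schwartzNorm s (ofRealTest (F q)) := by
    have h := norm_le_schwartzNorm s (ofRealTest (F q)) y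
    rwa [ofRealTest_apply, Complex.norm_real, Real.norm_eq_abs] at h
  exact h1.trans (Finset.single_le_sum (f := fun q' => schwartzNorm s (ofRealTest (F q')))
    (fun q' _ => schwartzNorm_nonneg _ _) (Finset.mem_univ q))

/-- **Uniform sup bound at a fixed step.** There is `B` (depending on `k`) with `|Φ^P_k(F)(U)| ≤ B` for every
normalised 6-tuple `F` (`normP s F ≤ 1`) and every configuration `U`. [folklore] -/
theorem exists_uniform_bound_fieldP (r : LatticeRep G) (S : SpeciesScheme (YMSpecies G)) (k s : ℕ) :
    ∃ B : ℝ, ∀ F : Plane → 𝓢(EuclideanSpace ℝ (Fin 4), ℝ), normP s F ≤ 1 →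
      ∀ U : GaugeConfig 4 (S.side k) G, |fieldP r S k F U| ≤ B := by
  choose Bw hBw using fun q : Plane => (planeSpecies r q).bounded
  refine ⟨∑ q : Plane, |S.c r.curvature k * S.a k ^ 4| *
    ∑ _x ∈ box 4 (S.L k), (Bw q + |S.m r.curvature k / 6|), fun F hF U => ?_⟩
  unfold fieldP
  refine (Finset.abs_sum_le_sum_abs _ _).trans (Finset.sum_le_sum fun q _ => ?_)
  unfold planeField smearedLatticeField
  rw [abs_mul]
  refine mul_le_mul_of_nonneg_left ((Finset.abs_sum_le_sum_abs _ _).trans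
    (Finset.sum_le_sum fun x _ => ?_)) (abs_nonneg _)
  rw [abs_mul]
  have h1 : |F q (S.a k • siteToE x)| ≤ 1 := (abs_apply_le_normP s F q _).trans hF
  have h2 : |(planeSpecies r q).F (configShift (-x) (torusLift (S.side k) U)) - S.m r.curvature k / 6| ≤
      Bw q + |S.m r.curvature k / 6| :=
    (abs_sub _ _).trans (add_le_add (hBw q _) le_rfl)
  calc |F q (S.a k • siteToE x)| *
        |(planeSpecies r q).F (configShift (-x) (torusLift (S.side k) U)) - S.m r.curvature k / 6|
      ≤ 1 * (Bw q + |S.m r.curvature k / 6|) := mul_le_mul h1 h2 (abs_nonneg _) zero_le_one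
    _ = Bw q + |S.m r.curvature k / 6| := one_mul _

/-- A non-zero anisotropic field reads a non-zero value of some component at some lattice point of the box. [folklore] -/
theorem exists_apply_ne_zero_of_fieldP_ne_zero (r : LatticeRep G) (S : SpeciesScheme (YMSpecies G)) (k : ℕ)
    (f : Plane → 𝓢(EuclideanSpace ℝ (Fin 4), ℝ)) (U : GaugeConfig 4 (S.side k) G)
    (h : fieldP r S k f U ≠ 0) : ∃ q : Plane, ∃ x ∈ box 4 (S.L k), f q (S.a k • siteToE x) ≠ 0 := by
  unfold fieldP at h
  obtain ⟨q, -, hq⟩ := Finset.exists_ne_zero_of_sum_ne_zero h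
  unfold planeField smearedLatticeField at hq
  have hs : ∑ x ∈ box 4 (S.L k), f q (S.a k • siteToE x) *
      ((planeSpecies r q).F (configShift (-x) (torusLift (S.side k) U)) - S.m r.curvature k / 6) ≠ 0 := by
    intro h0
    exact hq (by rw [h0, mul_zero])
  obtain ⟨x, hx, hx0⟩ := Finset.exists_ne_zero_of_sum_ne_zero hs
  exact ⟨q, x, hx, fun h0 => hx0 (by rw [h0, zero_mul])⟩

/-- **Pigeonhole.** If every field of a pairwise plane-wise disjointly supported family is non-zero at some
configuration, the family has at most `#box 4 L_k` members (distinct members need distinct lattice points). [folklore] -/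
theorem card_le_card_box (r : LatticeRep G) (S : SpeciesScheme (YMSpecies G)) (k : ℕ) {n : ℕ}
    (F : Fin n → Plane → 𝓢(EuclideanSpace ℝ (Fin 4), ℝ)) (hD : ∀ i j, i ≠ j → DisjP (F i) (F j))
    (U : GaugeConfig 4 (S.side k) G) (h : ∀ i, fieldP r S k (F i) U ≠ 0) : n ≤ (box 4 (S.L k)).card := by
  choose q x hx hne using fun i => exists_apply_ne_zero_of_fieldP_ne_zero r S k (F i) U (h i)
  have hinj : Function.Injective x := by
    intro i j hij
    by_contra hne'
    have hi : S.a k • siteToE (x i) ∈ tsupport (F i (q i)) :=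
      subset_tsupport _ (Function.mem_support.2 (hne i))
    have hj : S.a k • siteToE (x i) ∈ tsupport (F j (q j)) := by
      rw [hij]
      exact subset_tsupport _ (Function.mem_support.2 (hne j))
    exact Set.disjoint_left.1 (hD i j hne' (q i) (q j)) hi hj
  calc n = (Finset.univ.image x).card := by
        rw [Finset.card_image_of_injective _ hinj, Finset.card_univ, Fintype.card_fin]
    _ ≤ (box 4 (S.L k)).card := Finset.card_le_card (Finset.image_subset_iff.2 fun i _ => hx i)

/-- **Pointwise bound on the product, uniformly in `n`.** With `B` a uniform sup bound of the normalised fields at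
step `k`, `|∏ᵢ Φ^P_k(Fᵢ)(U)| ≤ (max 1 B)^{#box}` for every normalised pairwise plane-wise disjoint family. [folklore] -/
theorem abs_prod_fieldP_le (r : LatticeRep G) (S : SpeciesScheme (YMSpecies G)) (k : ℕ) {s : ℕ} {B : ℝ}
    (hB : ∀ F : Plane → 𝓢(EuclideanSpace ℝ (Fin 4), ℝ), normP s F ≤ 1 →
      ∀ U : GaugeConfig 4 (S.side k) G, |fieldP r S k F U| ≤ B)
    {n : ℕ} (F : Fin n → Plane → 𝓢(EuclideanSpace ℝ (Fin 4), ℝ)) (hF : ∀ i, normP s (F i) ≤ 1)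
    (hD : ∀ i j, i ≠ j → DisjP (F i) (F j)) (U : GaugeConfig 4 (S.side k) G) :
    |∏ i, fieldP r S k (F i) U| ≤ max 1 B ^ (box 4 (S.L k)).card := by
  by_cases h0 : ∃ i, fieldP r S k (F i) U = 0
  · obtain ⟨i, hi⟩ := h0
    rw [Finset.prod_eq_zero (Finset.mem_univ i) hi, abs_zero]
    exact pow_nonneg (zero_le_one.trans (le_max_left 1 B)) _
  · push Not at h0
    have hn : n ≤ (box 4 (S.L k)).card := card_le_card_box r S k F hD U h0
    rw [Finset.abs_prod]
    calc ∏ i, |fieldP r S k (F i) U| ≤ ∏ _i : Fin n, max 1 B :=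
          Finset.prod_le_prod (fun i _ => abs_nonneg _) fun i _ => (hB (F i) (hF i) U).trans (le_max_right 1 B)
      _ = max 1 B ^ n := by rw [Finset.prod_const, Finset.card_univ, Fintype.card_fin]
      _ ≤ max 1 B ^ (box 4 (S.L k)).card := pow_le_pow_right₀ (le_max_left 1 B) hn

/-- **The moment bound at a fixed step, uniformly in `n`** (Wilson's torus measure is a probability measure). [folklore] -/
theorem abs_integral_prod_fieldP_le (r : LatticeRep G) (S : SpeciesScheme (YMSpecies G)) (k : ℕ) {s : ℕ} {B : ℝ}
    (hB : ∀ F : Plane → 𝓢(EuclideanSpace ℝ (Fin 4), ℝ), normP s F ≤ 1 →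
      ∀ U : GaugeConfig 4 (S.side k) G, |fieldP r S k F U| ≤ B)
    {n : ℕ} (F : Fin n → Plane → 𝓢(EuclideanSpace ℝ (Fin 4), ℝ)) (hF : ∀ i, normP s (F i) ≤ 1)
    (hD : ∀ i j, i ≠ j → DisjP (F i) (F j)) :
    |∫ U, ∏ i, fieldP r S k (F i) U ∂(wilsonAt r S k)| ≤ max 1 B ^ (box 4 (S.L k)).card := by
  haveI : IsProbabilityMeasure (wilsonAt r S k) :=
    isProbabilityMeasure_wilsonMeasure (d := 4) (L := S.side k) r.ρ r.continuous (S.β k)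
  have h := norm_integral_le_of_norm_le_const (μ := wilsonAt r S k)
    (f := fun U => ∏ i, fieldP r S k (F i) U) (C := max 1 B ^ (box 4 (S.L k)).card)
    (Eventually.of_forall fun U => by
      rw [Real.norm_eq_abs]
      exact abs_prod_fieldP_le r S k hB F hF hD U)
  rwa [probReal_univ, mul_one, Real.norm_eq_abs] at h

end StubEventually

open StubEventually in
/-- **Registered stub `stub_eventually` (line `Sketch`).**  If the plane-resolved moment bound holds for all
`k ≥ k₀`, it holds for all `k` (with other constants): at a fixed step the lattice is finite, a family of pairwise
plane-wise disjointly supported 6-tuples has at most `(2L_k+1)⁴` members whose field is not identically zero (each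
needs its own lattice point), and each normalised field is bounded by a constant `B_k`; so finitely many `k` are
absorbed into `C₀`. [folklore] -/
theorem stub_eventually :
    ∀ (G : Type) [Group G] [TopologicalSpace G] [IsTopologicalGroup G] [CompactSpace G] [MeasurableSpace G]
      [BorelSpace G] (r : LatticeRep G) (S : SpeciesScheme (YMSpecies G)),
      (∃ (s k₀ : ℕ) (C₀ C₁ : ℝ), ∀ (n : ℕ) (F : Fin n → Plane → 𝓢(EuclideanSpace ℝ (Fin 4), ℝ)),
        (∀ i, normP s (F i) ≤ 1) → (∀ i j, i ≠ j → DisjP (F i) (F j)) →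
          ∀ k : ℕ, k₀ ≤ k → |∫ U, ∏ i, fieldP r S k (F i) U ∂(wilsonAt r S k)| ≤ C₀ * C₁ ^ n * n.factorial) →
      UniformMomentBoundsPlanes r S := by
  rintro G _ _ _ _ _ _ r S ⟨s, k₀, C₀, C₁, H⟩
  -- per-step uniform sup bounds of the normalised fields and the per-step moment bounds `D k`
  choose B hB using fun k => exists_uniform_bound_fieldP r S k s
  set D : ℕ → ℝ := fun k => max 1 (B k) ^ (box 4 (S.L k)).card with hD_def
  have hD0 : ∀ k, 0 ≤ D k := fun k => pow_nonneg (zero_le_one.trans (le_max_left 1 (B k))) _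
  have hDk : ∀ (k n : ℕ) (F : Fin n → Plane → 𝓢(EuclideanSpace ℝ (Fin 4), ℝ)),
      (∀ i, normP s (F i) ≤ 1) → (∀ i j, i ≠ j → DisjP (F i) (F j)) →
        |∫ U, ∏ i, fieldP r S k (F i) U ∂(wilsonAt r S k)| ≤ D k :=
    fun k n F hF hDj => abs_integral_prod_fieldP_le r S k (hB k) F hF hDj
  refine ⟨s, |C₀| + ∑ k ∈ Finset.range k₀, D k, max |C₁| 1, fun n F hF hDj k => ?_⟩
  have hsum0 : 0 ≤ ∑ k ∈ Finset.range k₀, D k := Finset.sum_nonneg fun k _ => hD0 k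
  have hC0 : 0 ≤ |C₀| + ∑ k ∈ Finset.range k₀, D k := add_nonneg (abs_nonneg _) hsum0
  have hC1 : 1 ≤ max |C₁| 1 := le_max_right _ _
  have hfac : (1 : ℝ) ≤ n.factorial := by exact_mod_cast Nat.succ_le_of_lt (Nat.factorial_pos n)
  rcases le_or_gt k₀ k with hk | hk
  · -- the tail: the hypothesis, with `|C₀| |C₁|ⁿ ≤ C₀' C₁'ⁿ`
    refine (H n F hF hDj k hk).trans ?_
    have h1 : C₀ * C₁ ^ n ≤ |C₀| * |C₁| ^ n := by
      rw [← abs_pow, ← abs_mul]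
      exact le_abs_self _
    have h2 : |C₀| * |C₁| ^ n ≤ (|C₀| + ∑ k ∈ Finset.range k₀, D k) * max |C₁| 1 ^ n :=
      mul_le_mul (le_add_of_nonneg_right hsum0) (pow_le_pow_left₀ (abs_nonneg _) (le_max_left _ _) n)
        (pow_nonneg (abs_nonneg _) n) hC0
    exact mul_le_mul_of_nonneg_right (h1.trans h2) (Nat.cast_nonneg _)
  · -- finitely many early steps: `D k ≤ C₀' ≤ C₀' C₁'ⁿ n!`
    refine (hDk k n F hF hDj).trans ?_
    have h1 : D k ≤ |C₀| + ∑ k ∈ Finset.range k₀, D k :=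
      (Finset.single_le_sum (f := D) (fun k _ => hD0 k) (Finset.mem_range.2 hk)).trans
        (le_add_of_nonneg_left (abs_nonneg _))
    calc D k ≤ (|C₀| + ∑ k ∈ Finset.range k₀, D k) * 1 * 1 := by rwa [mul_one, mul_one]
      _ ≤ (|C₀| + ∑ k ∈ Finset.range k₀, D k) * max |C₁| 1 ^ n * n.factorial :=
        mul_le_mul (mul_le_mul_of_nonneg_left (one_le_pow₀ hC1) hC0) hfac zero_le_one
          (mul_nonneg hC0 (pow_nonneg (zero_le_one.trans hC1) n))

end Summit.QuantumFields.YangMills.Theorems.ScalingWindowSplit.SelfNormalisedMomentBoundsR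

end
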